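import Summits.ValiantsHypothesis.ValiantsHypothesis.Theorems.SymPencilIsotropicKernelDefect
import Literature.Computability.AlgebraicComplexity.AlperBogartVelascoBoxThree

/-!
# Route `SymPencil` — isotropic kernel rows with defect `d`: the `s²`-coefficient has a large radical
# (core linear algebra of the rung `sdc(per_4) ≥ 21`, `--supports` stmt-ValiantsHypothesis-5674)

Same data and origin-moment hypotheses (i)–(iii) as
`SymPencilIsotropicKernelDefect.sq_of_isotropic_defect_le_one`, with the defect hypothesis relaxed
to `|ι'| ≤ 2 dim (im b) + d` for an arbitrary `d` (for a symmetric representation of `per_4` of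
size `m` with `dim ker b = 8` the defect is `d = m - 17`).  Conclusion
(`radical_of_isotropic_defect`): for every `u`, along `ker b`,

  `φ (u + s x) = e₀ + s e₁ + s² e₂(x)`,   `e₂(x) = -det D · w_xᵀ D⁻¹ w_x / κ`,  `w_x = C(x) D⁻¹ b(u)`,

and there is a subspace `N ≤ ker b` of codimension `≤ d` in `ker b` which lies in the RADICAL of
`e₂`: `e₂ (x₀ + x) = e₂ (x)` for `x₀ ∈ N`, `x ∈ ker b`.

Proof.  With `B := im b`, `B^⊥ ⊇ D⁻¹ B =: B'` has codimension `≤ d`; the form `t ↦ tᵀ D t` on `B^⊥`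
has `B'` in its radical; `t_x := D⁻¹ w_x ∈ B^⊥` for `x ∈ ker b` (first moment, polarised), and
`e₂(x) ∝ t_xᵀ D t_x`; take `N := {x ∈ ker b : t_x ∈ B'}`, the kernel of `ker b → B^⊥ → B^⊥/B'`.
[folklore]
-/

noncomputable section

-- single-conjunct layout: Sub = Summit, duplicated namespace component intended
set_option linter.dupNamespace false

namespace Summit.ValiantsHypothesis.ValiantsHypothesis.Theorems.SymPencilIsotropicKernelRadical

open Matrix Module
open Summit.ValiantsHypothesis.ValiantsHypothesis.Theorems.SymPencilLagrangianKernel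
open Literature.Computability.AlgebraicComplexity.AlperBogartVelasco

universe u

variable {k : Type u} [Field k] [CharZero k] {ι' : Type*} [Fintype ι'] [DecidableEq ι']
  {V : Type*} [AddCommGroup V] [Module k V] [FiniteDimensional k V]

/-- **Isotropic kernel rows with defect `d`: the `s²`-coefficient along `ker b` is a quadratic
form with a radical of codimension `≤ d`.**  See the module docstring. [folklore] -/
theorem radical_of_isotropic_defect {D : Matrix ι' ι' k} (hD : IsUnit D.det) (hDs : Dᵀ = D)
    (b : V →ₗ[k] (ι' → k)) (C : V →ₗ[k] Matrix ι' ι' k) (hCs : ∀ z, (C z)ᵀ = C z)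
    (φ : V → k) {κ : k} (hκ : κ ≠ 0)
    (hi : ∀ z, b z ⬝ᵥ D⁻¹ *ᵥ b z = 0)
    (hii : ∀ z, b z ⬝ᵥ (D⁻¹ * C z * D⁻¹) *ᵥ b z = 0)
    (hiii : ∀ z, D.det * (b z ⬝ᵥ (D⁻¹ * C z * D⁻¹ * C z * D⁻¹) *ᵥ b z) = -(κ * φ z))
    (d : ℕ) (hL : Fintype.card ι' ≤ 2 * Module.finrank k (LinearMap.range b) + d) (u : V) :
    ∃ N : Submodule k V, N ≤ LinearMap.ker b ∧
      finrank k (LinearMap.ker b) ≤ finrank k N + d ∧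
      ∃ e₂ : V → k,
        (∀ x : V, b x = 0 → ∃ e₀ e₁ : k, ∀ s : k,
          φ (u + s • x) = e₀ + s * e₁ + s ^ 2 * e₂ x) ∧
        (∀ x₀ ∈ N, ∀ x : V, b x = 0 → e₂ (x₀ + x) = e₂ x) := by
  classical
  have hDis : (D⁻¹)ᵀ = D⁻¹ := by rw [Matrix.transpose_nonsing_inv, hDs]
  set B := LinearMap.range b with hBdef
  -- (1) polarised isotropy on `B`
  have hsymm0 : ∀ y y' : ι' → k, y ⬝ᵥ D⁻¹ *ᵥ y' = y' ⬝ᵥ D⁻¹ *ᵥ y := fun y y' => by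
    rw [dotProduct_mulVec_of_transpose_eq hDis, dotProduct_comm]
  have hpol : ∀ y ∈ B, ∀ y' ∈ B, y ⬝ᵥ D⁻¹ *ᵥ y' = 0 := by
    rintro _ ⟨z, rfl⟩ _ ⟨z', rfl⟩
    have h := hi (z + z')
    rw [map_add, Matrix.mulVec_add, dotProduct_add, add_dotProduct, add_dotProduct, hi z, hi z',
      hsymm0 (b z') (b z), zero_add, add_zero, ← two_mul] at h
    exact (mul_eq_zero.1 h).resolve_left two_ne_zero
  -- (2) first moment along the kernel, polarised
  have hker1 : ∀ z v, b v = 0 → (D⁻¹ *ᵥ b z) ⬝ᵥ C v *ᵥ (D⁻¹ *ᵥ b z) = 0 := by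
    intro z v hv
    have h1 := hii (z + v)
    have h0 := hii z
    rw [map_add, hv, add_zero, map_add, sandwich₂_eq hDis, Matrix.add_mulVec, dotProduct_add] at h1
    rw [sandwich₂_eq hDis] at h0
    rwa [h0, zero_add] at h1
  have hsymm1 : ∀ v (p q : ι' → k), p ⬝ᵥ C v *ᵥ q = q ⬝ᵥ C v *ᵥ p := fun v p q => by
    rw [dotProduct_mulVec_of_transpose_eq (hCs v), dotProduct_comm]
  have hker2 : ∀ y ∈ B, ∀ y' ∈ B, ∀ v, b v = 0 → (D⁻¹ *ᵥ y) ⬝ᵥ C v *ᵥ (D⁻¹ *ᵥ y') = 0 := by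
    rintro _ ⟨z, rfl⟩ _ ⟨z', rfl⟩ v hv
    have h := hker1 (z + z') v hv
    rw [map_add, Matrix.mulVec_add, Matrix.mulVec_add, dotProduct_add, add_dotProduct,
      add_dotProduct, hker1 z v hv, hker1 z' v hv, hsymm1 v (D⁻¹ *ᵥ b z') (D⁻¹ *ᵥ b z), zero_add,
      add_zero, ← two_mul] at h
    exact (mul_eq_zero.1 h).resolve_left two_ne_zero
  -- (3) `B^⊥` as the kernel of the pairing with a basis of `B`, and `B' = D⁻¹ B ≤ B^⊥`
  let yB := Module.finBasis k B
  set r := Module.finrank k B with hr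
  let Y : Matrix (Fin r) ι' k := Matrix.of fun i j => (yB i : ι' → k) j
  have hYrow : ∀ i, Y i = (yB i : ι' → k) := fun i => rfl
  let Bp : Submodule k (ι' → k) := LinearMap.ker Y.mulVecLin
  have memBp : ∀ t, t ∈ Bp ↔ ∀ y ∈ B, y ⬝ᵥ t = 0 := by
    intro t
    constructor
    · intro ht y hy
      rw [LinearMap.mem_ker, Matrix.mulVecLin_apply] at ht
      have hbas : ∀ i, (yB i : ι' → k) ⬝ᵥ t = 0 := fun i => by
        have := congr_fun ht i
        rwa [Matrix.mulVec, hYrow] at this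
      let φ' : B →ₗ[k] k :=
        { toFun := fun y => (y : ι' → k) ⬝ᵥ t
          map_add' := fun y₁ y₂ => by simp only [Submodule.coe_add, add_dotProduct]
          map_smul' := fun c y => by
            simp only [Submodule.coe_smul, smul_dotProduct, smul_eq_mul, RingHom.id_apply] }
      have hφ : φ' = 0 := yB.ext fun i => by rw [LinearMap.zero_apply]; exact hbas i
      have := LinearMap.congr_fun hφ ⟨y, hy⟩
      rwa [LinearMap.zero_apply] at this
    · intro ht
      rw [LinearMap.mem_ker, Matrix.mulVecLin_apply]
      ext i
      rw [Matrix.mulVec, hYrow, Pi.zero_apply]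
      exact ht _ (yB i).2
  let B' : Submodule k (ι' → k) := Submodule.map (D⁻¹).mulVecLin B
  have memB' : ∀ t, t ∈ B' ↔ ∃ y ∈ B, t = D⁻¹ *ᵥ y := fun t => by
    constructor
    · rintro ⟨y, hy, rfl⟩; exact ⟨y, hy, rfl⟩
    · rintro ⟨y, hy, rfl⟩; exact ⟨y, hy, rfl⟩
  have hB'le : B' ≤ Bp := by
    rintro _ ⟨y', hy', rfl⟩
    rw [memBp]
    intro y hy
    exact hpol _ hy _ hy'
  have hDiu : IsUnit D⁻¹ :=
    (Matrix.isUnit_iff_isUnit_det _).2 (Matrix.isUnit_nonsing_inv_det_iff.2 hD)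
  have hinj : Function.Injective (D⁻¹).mulVecLin := Matrix.mulVec_injective_iff_isUnit.2 hDiu
  have hB'dim : Module.finrank k B' = r := (Submodule.equivMapOfInjective _ hinj B).finrank_eq.symm
  have hYrank : Y.rank = r := by
    rw [Matrix.rank_eq_finrank_span_row]
    have hrange : Set.range Y.row = B.subtype '' Set.range yB := by
      ext q
      simp only [Set.mem_range, Set.mem_image, Submodule.coe_subtype, Matrix.row, hYrow]
      constructor
      · rintro ⟨i, rfl⟩; exact ⟨yB i, ⟨i, rfl⟩, rfl⟩
      · rintro ⟨_, ⟨i, rfl⟩, rfl⟩; exact ⟨i, rfl⟩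
    rw [hrange, Submodule.span_image, yB.span_eq, Submodule.map_top, Submodule.range_subtype]
  have hBpdim : Module.finrank k Bp ≤ r + d := by
    have h := LinearMap.finrank_range_add_finrank_ker Y.mulVecLin
    rw [Module.finrank_fintype_fun_eq_card] at h
    change Y.rank + Module.finrank k Bp = _ at h
    omega
  -- the radical of `t ↦ tᵀ D t` on `B^⊥` contains `B'`
  have hrad : ∀ y ∈ B, ∀ t ∈ Bp, (D⁻¹ *ᵥ y) ⬝ᵥ D *ᵥ t = 0 := by
    intro y hy t ht
    rw [dotProduct_mulVec_of_transpose_eq hDs, Matrix.mulVec_mulVec, Matrix.mul_nonsing_inv _ hD,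
      Matrix.one_mulVec]
    exact (memBp t).1 ht y hy
  have hrad' : ∀ t₀ ∈ B', ∀ t ∈ Bp, (D *ᵥ t₀) ⬝ᵥ t = 0 ∧ (D *ᵥ t) ⬝ᵥ t₀ = 0 := by
    intro t₀ ht₀ t ht
    obtain ⟨y, hy, rfl⟩ := (memB' t₀).1 ht₀
    have h1 : (D *ᵥ (D⁻¹ *ᵥ y)) ⬝ᵥ t = 0 := by
      rw [← dotProduct_mulVec_of_transpose_eq hDs]; exact hrad y hy t ht
    refine ⟨h1, ?_⟩
    rw [← dotProduct_mulVec_of_transpose_eq hDs, dotProduct_comm]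
    exact h1
  -- (4) fix `u`; the map `x ↦ t_x = D⁻¹ C(x) D⁻¹ b(u)` sends `ker b` into `B^⊥`
  set p := D⁻¹ *ᵥ b u with hp
  have hpB : b u ∈ B := ⟨u, rfl⟩
  let L : V →ₗ[k] (ι' → k) :=
    { toFun := fun x => D⁻¹ *ᵥ (C x *ᵥ p)
      map_add' := fun x₁ x₂ => by simp only [map_add, Matrix.add_mulVec, Matrix.mulVec_add]
      map_smul' := fun a x => by
        simp only [map_smul, Matrix.smul_mulVec, Matrix.mulVec_smul, RingHom.id_apply] }
  have hL : ∀ x, L x = D⁻¹ *ᵥ (C x *ᵥ p) := fun x => rfl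
  have hLBp : ∀ x, b x = 0 → L x ∈ Bp := by
    intro x hx
    rw [memBp]
    intro y' hy'
    rw [hL, dotProduct_mulVec_of_transpose_eq hDis, hsymm1]
    exact hker2 _ hpB y' hy' x hx
  have hDL : ∀ x, D *ᵥ L x = C x *ᵥ p := fun x => by
    rw [hL, Matrix.mulVec_mulVec, Matrix.mul_nonsing_inv _ hD, Matrix.one_mulVec]
  -- `N := {x ∈ ker b : t_x ∈ B'}`, the kernel of `ker b → B^⊥ → B^⊥ / B'`
  let f : LinearMap.ker b →ₗ[k] (ι' → k) ⧸ B' := B'.mkQ ∘ₗ L ∘ₗ (LinearMap.ker b).subtype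
  let N : Submodule k V := (LinearMap.ker f).map (LinearMap.ker b).subtype
  have hNle : N ≤ LinearMap.ker b := Submodule.map_subtype_le _ _
  have memN : ∀ x₀ ∈ N, b x₀ = 0 ∧ L x₀ ∈ B' := by
    rintro _ ⟨z, hz, rfl⟩
    refine ⟨LinearMap.mem_ker.1 z.2, ?_⟩
    have hz' : f z = 0 := LinearMap.mem_ker.1 (SetLike.mem_coe.1 hz)
    change B'.mkQ (L z) = 0 at hz'
    rwa [Submodule.mkQ_apply, Submodule.Quotient.mk_eq_zero] at hz'
  have hNdim : finrank k (LinearMap.ker b) ≤ finrank k N + d := by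
    have hN : finrank k N = finrank k (LinearMap.ker f) :=
      (Submodule.equivMapOfInjective _ (Submodule.injective_subtype _) _).finrank_eq.symm
    have hrn := LinearMap.finrank_range_add_finrank_ker f
    have hrange : LinearMap.range f ≤ Bp.map B'.mkQ := by
      rintro _ ⟨z, rfl⟩
      exact ⟨L z, hLBp z (LinearMap.mem_ker.1 z.2), rfl⟩
    have hq : finrank k ↥(Bp.map B'.mkQ) ≤ d := by
      have h := finrank_eq_finrank_map_add_finrank_inf_ker Bp B'.mkQ
      rw [Submodule.ker_mkQ, inf_eq_right.2 hB'le, hB'dim] at h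
      omega
    have := Submodule.finrank_mono hrange
    omega
  -- the `s²`-coefficient and its radical
  refine ⟨N, hNle, hNdim, fun x => -(D.det * ((C x *ᵥ p) ⬝ᵥ D⁻¹ *ᵥ (C x *ᵥ p))) / κ, ?_, ?_⟩
  · intro x hx
    set wu := C u *ᵥ p with hwu
    set wx := C x *ᵥ p with hwx
    refine ⟨-(D.det * (wu ⬝ᵥ D⁻¹ *ᵥ wu)) / κ, -(D.det * (wu ⬝ᵥ D⁻¹ *ᵥ wx + wx ⬝ᵥ D⁻¹ *ᵥ wu)) / κ,
      fun s => ?_⟩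
    have h := hiii (u + s • x)
    have hbz : b (u + s • x) = b u := by rw [map_add, map_smul, hx, smul_zero, add_zero]
    rw [hbz, sandwich_eq hDis (hCs _), map_add, map_smul, Matrix.add_mulVec, Matrix.smul_mulVec,
      ← hp, ← hwu, ← hwx, Matrix.mulVec_add, Matrix.mulVec_smul, dotProduct_add, add_dotProduct,
      add_dotProduct, dotProduct_smul, smul_dotProduct, smul_dotProduct, dotProduct_smul] at h
    simp only [smul_eq_mul] at h
    field_simp
    linear_combination h
  · intro x₀ hx₀ x hx
    obtain ⟨hbx₀, hLx₀⟩ := memN x₀ hx₀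
    have ht : L x ∈ Bp := hLBp x hx
    obtain ⟨h1, h2⟩ := hrad' (L x₀) hLx₀ (L x) ht
    obtain ⟨h0, -⟩ := hrad' (L x₀) hLx₀ (L x₀) (hB'le hLx₀)
    -- rewrite the three pairings through `w = D t`
    have e1 : (C x₀ *ᵥ p) ⬝ᵥ D⁻¹ *ᵥ (C x *ᵥ p) = 0 := by rw [hDL] at h1; exact h1
    have e2 : (C x *ᵥ p) ⬝ᵥ D⁻¹ *ᵥ (C x₀ *ᵥ p) = 0 := by rw [hDL] at h2; exact h2
    have e0 : (C x₀ *ᵥ p) ⬝ᵥ D⁻¹ *ᵥ (C x₀ *ᵥ p) = 0 := by rw [hDL] at h0; exact h0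
    simp only [map_add, Matrix.add_mulVec, Matrix.mulVec_add, dotProduct_add, add_dotProduct, e0, e1,
      e2, zero_add, add_zero]

end Summit.ValiantsHypothesis.ValiantsHypothesis.Theorems.SymPencilIsotropicKernelRadical

end
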